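import Literature.Barriers.Parity.SiegelZeroDichotomyPairHLLemma51
import Mathlib.NumberTheory.LSeries.Nonvanishing
import HarnessLib

/-!
# Matomäki–Merikoski, §2 "Initial steps": the identities (2.2)–(2.5) and the expansion (2.6)

Sibling of `Literature/Barriers/Parity/SiegelZeroPrimePairs.lean` (the catalogue entry vendoring
Matomäki–Merikoski, *Siegel zeros, twin primes, Goldbach's conjecture, and primes in short
intervals* (IMRN 2023; arXiv:2112.11412), Theorem 1.3 as the named fact
`Literature.Barriers.Parity.MatomakiMerikoski2023_pairCorrelation`). §2 of the source reduces
Theorems 1.3/1.4 to the study of `∑ g(n/X) λ'(n) λ'(±n+h)` over `n` coprime to `qP(z)`, with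
`λ = 1 ∗ χ`, `λ' = χ ∗ log` ((2.1)) and the error controlled by `c_n` ((2.5)) through Lemmas 2.1–2.2.
This file PROVES the elementary identities and inequalities of that reduction, on the tree's
Tao–Teräväinen objects `TaoTeravainen.oneConvChi χ = λ` and `TaoTeravainen.charLog χ = λ'`
(`SiegelZeroDichotomyPairHLLemma51.lean`, where `λ' = λ ∗ Λ` is `TaoTeravainen.charLog_eq_sum`);
theorems only, no definition and no named fact:

* `oneConvChi_eq_re_zetaMul` — the bridge `oneConvChi χ n = Re (DirichletCharacter.zetaMul χ n)`
  to the rendering of `λ` used in `SiegelZeroPrimePairsRoughSums.lean` / `…Lemma41.lean`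
  (Lemmas 2.2, 4.1); `oneConvChi_nonneg` — "`λ(n) ≥ 0`" for quadratic `χ`;
* `vonMangoldt_le_charLog`, `charLog_nonneg`, `charLog_le`, `charLog_sub_vonMangoldt_bounds` —
  "`λ'(n) ≥ Λ(n) ≥ 0`", "`0 ≤ λ'(n) ≤ τ(n) log n`", and for `c_n := λ'(n) − Λ(n)` ((2.2):
  `= ∑_{n = km, m > 1} Λ(k)λ(m)`): `0 ≤ c_n ≤ τ(n) log n`;
* `vonMangoldt_eq_charLog_sub_of_rough` — (2.4)/(2.5) on the `n` coprime to `P(z)`: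
  `Λ(n) = λ'(n) − ∑_{n = km, m ≥ z} Λ(k)λ(m)` (every divisor `m > 1` of a `z`-rough `n` is `≥ z`,
  `le_of_dvd_of_rough`); `eq_prime_pow_of_vonMangoldt_ne_zero` — the exceptional `n` of (2.4) are
  prime powers `p^ν` with `p ∣ qP(z)`;
* `MatomakiMerikoski2023_eq26` — **(2.6)** for the sign `+`: for `0 ≤ g ≤ 1` supported on
  `[1, 2]`, `X ≥ 1`, `h ∈ ℕ`, `q ≥ 1`, real `z`,
  `|∑_{n ≤ 2X} g(n/X)Λ(n)Λ(n+h) − ∑_{n ≤ 2X, (n(n+h), qP(z)) = 1} g(n/X)λ'(n)λ'(n+h)|`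
  `≤ 4(π(z) + ω(q)) log²(2X+h) + log(2X+h) ∑_{n ≤ 2X, (n(n+h),qP(z))=1} (τ(n) c_{n+h} + c_n)`
  ("`(m, qP(z)) = 1`" rendered as: every prime factor of `m` is `≥ z` and coprime to `q`), which
  implies the printed `O((z + ω(q)) log² X + log X ∑(c_n τ(n+h)² + τ(n) c_{n+h}))` for `h ≪ X^{O(1)}`;
  the count of exceptional `n` uses `card_filter_pow_le_two` (a dyadic window contains at most two
  powers of a prime).

NOT here: the smoothing/dyadic decomposition at the start of §2, Lemma 2.1 (Henriot's bound), and
the `−` sign (Goldbach case, Theorem 1.4).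

## References

* K. Matomäki, J. Merikoski, *Siegel zeros, twin primes, Goldbach's conjecture, and primes in
  short intervals*, IMRN 2023:23, 20337–20384 (arXiv:2112.11412): §2 "Initial steps",
  (2.1)–(2.6) (read in the held text, `lit read arxiv:2112.11412`, chunks p0006–p0007).
  [cite: MatomakiMerikoski2023, §2 (2.1)–(2.6)]
* T. Tao, J. Teräväinen, *The Hardy–Littlewood–Chowla conjecture in the presence of a Siegel
  zero*, J. London Math. Soc. 106 (2022), §5 (the objects `1 ∗ χ`, `χ ∗ log` of the tree's
  `SiegelZeroDichotomyPairHLLemma51.lean`). [cite: TaoTeravainen2021, §5]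
-/

noncomputable section

open Finset
open scoped ArithmeticFunction.vonMangoldt

namespace Literature.Barriers.Parity.MatomakiMerikoski

open Literature.Barriers.Parity.TaoTeravainen

variable {N : ℕ} (χ : DirichletCharacter ℂ N)

/-! ### `λ = 1 ∗ χ` and `λ' = χ ∗ log`: signs and sizes ((2.1)–(2.2)) -/

/-- The tree's two renderings of `λ = 1 ∗ χ` agree: Tao–Teräväinen's real arithmetic function
`oneConvChi χ` is the real part of Mathlib's `DirichletCharacter.zetaMul χ`. [folklore] -/
theorem oneConvChi_eq_re_zetaMul (n : ℕ) : oneConvChi χ n = (χ.zetaMul n).re := by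
  rw [oneConvChi_apply, DirichletCharacter.zetaMul, ArithmeticFunction.coe_zeta_mul_apply,
    Complex.re_sum]
  refine Finset.sum_congr rfl fun d hd => ?_
  have hd0 : d ≠ 0 := (Nat.pos_of_mem_divisors hd).ne'
  simp [realChar, toArithmeticFunction, hd0]

/-- **`λ(n) ≥ 0`** for a quadratic character ("Note also that `λ(n) ≥ 0`", after (2.1); Mathlib's
`DirichletCharacter.zetaMul_nonneg`). [cite: MatomakiMerikoski2023, §2 (after (2.1))] -/
theorem oneConvChi_nonneg (hχ : χ.IsQuadratic) (n : ℕ) : 0 ≤ oneConvChi χ n := by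
  rw [oneConvChi_eq_re_zetaMul]
  exact (Complex.nonneg_iff.mp
    (DirichletCharacter.zetaMul_nonneg (MulChar.isQuadratic_iff_sq_eq_one.mp hχ) n)).1

/-- **(2.2): `λ'(n) − Λ(n) = ∑_{n = km, m > 1} Λ(k) λ(m) ≥ 0`** for quadratic `χ` ("so we have
obtained a formula for the error term in the approximation (eq:LambdaApprox)"; the identity is the
tree's `TaoTeravainen.charLog_sub_vonMangoldt`, `λ' = λ ∗ Λ`).
[cite: MatomakiMerikoski2023, §2 (2.2)] -/
theorem vonMangoldt_le_charLog (hχ : χ.IsQuadratic) {n : ℕ} (hn : n ≠ 0) : Λ n ≤ charLog χ n := by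
  have h := charLog_sub_vonMangoldt χ hn
  have h0 : 0 ≤ ∑ d ∈ n.divisors.erase 1, oneConvChi χ d * Λ (n / d) :=
    Finset.sum_nonneg fun d _ => mul_nonneg (oneConvChi_nonneg χ hχ d)
      ArithmeticFunction.vonMangoldt_nonneg
  linarith

/-- `λ'(n) ≥ 0` ("`λ'(n) ≥ Λ(n) ≥ 0`"). [cite: MatomakiMerikoski2023, §2 (after (2.1))] -/
theorem charLog_nonneg (hχ : χ.IsQuadratic) (n : ℕ) : 0 ≤ charLog χ n := by
  rcases Nat.eq_zero_or_pos n with rfl | hn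
  · simp [charLog]
  · exact ArithmeticFunction.vonMangoldt_nonneg.trans (vonMangoldt_le_charLog χ hχ hn.ne')

/-- **`λ'(n) ≤ τ(n) log n`** ("Note that `0 ≤ λ'(n) ≤ τ(n) log n`").
[cite: MatomakiMerikoski2023, §2 (before (2.6))] -/
theorem charLog_le (n : ℕ) : charLog χ n ≤ (n.divisors.card : ℝ) * Real.log n := by
  rcases Nat.eq_zero_or_pos n with rfl | hn
  · simp [charLog]
  rw [charLog_eq_sum]
  calc ∑ d ∈ n.divisors, oneConvChi χ d * Λ (n / d)
      ≤ ∑ d ∈ n.divisors, (n.divisors.card : ℝ) * Λ (n / d) := by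
        refine Finset.sum_le_sum fun d hd => ?_
        refine mul_le_mul_of_nonneg_right ?_ ArithmeticFunction.vonMangoldt_nonneg
        have hdn : d ∣ n := Nat.dvd_of_mem_divisors hd
        calc oneConvChi χ d ≤ |oneConvChi χ d| := le_abs_self _
          _ ≤ (d.divisors.card : ℝ) := abs_oneConvChi_le χ d
          _ ≤ (n.divisors.card : ℝ) := by
              exact_mod_cast Finset.card_le_card (Nat.divisors_subset_of_dvd hn.ne' hdn)
    _ = (n.divisors.card : ℝ) * Real.log n := by
        rw [← Finset.mul_sum, Nat.sum_div_divisors n (fun d => Λ d),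
          ArithmeticFunction.vonMangoldt_sum]

/-- The error `c(n) := λ'(n) − Λ(n)` satisfies `0 ≤ c(n) ≤ τ(n) log n` ("`0 ≤ c_n ≤ 1_{(n,P(z))=1}
τ(n)² log n`"; here without the roughness restriction and with one `τ`).
[cite: MatomakiMerikoski2023, §2 (2.5) and before (2.6)] -/
theorem charLog_sub_vonMangoldt_bounds (hχ : χ.IsQuadratic) {n : ℕ} (hn : n ≠ 0) :
    0 ≤ charLog χ n - Λ n ∧ charLog χ n - Λ n ≤ (n.divisors.card : ℝ) * Real.log n := by
  refine ⟨by linarith [vonMangoldt_le_charLog χ hχ hn], ?_⟩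
  rw [charLog_sub_vonMangoldt χ hn]
  refine le_trans (Finset.sum_le_sum fun d _ => ?_) (sum_abs_oneConvChi_mul_le χ n)
  exact mul_le_mul_of_nonneg_right (le_abs_self _) ArithmeticFunction.vonMangoldt_nonneg

/-! ### (2.3)–(2.4): restricting to numbers coprime to `q P(z)` -/

/-- A divisor `m ≠ 1` of an `n ≥ 1` all of whose prime factors are `≥ z` is itself `≥ z` (indeed its
least prime factor is) — the mechanism behind "Adding the condition `(n, qP(z)) = 1` … we get
(2.4)" with the restriction `m ≥ z` in `c_n`. [cite: MatomakiMerikoski2023, §2 (2.3)–(2.5)] -/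
theorem le_of_dvd_of_rough {z : ℝ} {n m : ℕ} (hn : n ≠ 0)
    (hrough : ∀ p ∈ n.primeFactors, z ≤ (p : ℝ)) (hmn : m ∣ n) (hm1 : m ≠ 1) : z ≤ (m : ℝ) := by
  have hm0 : m ≠ 0 := fun h => hn (Nat.eq_zero_of_zero_dvd (h ▸ hmn))
  have hp := Nat.minFac_prime hm1
  have hpn : m.minFac ∈ n.primeFactors :=
    Nat.mem_primeFactors.mpr ⟨hp, (Nat.minFac_dvd m).trans hmn, hn⟩
  calc z ≤ (m.minFac : ℝ) := hrough _ hpn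
    _ ≤ m := by exact_mod_cast Nat.minFac_le (Nat.pos_of_ne_zero hm0)

/-- **(2.4)/(2.5) on the admissible `n`**: if every prime factor of `n ≥ 1` is `≥ z > 1`, then
`Λ(n) = λ'(n) − c_n` with `c_n = ∑_{n = km, m ≥ z} Λ(k) λ(m)` ("`Λ(n) = λ'(n)1_{(n,qP(z))=1} −
∑_{n = km, m ≥ z, (km, qP(z)) = 1} Λ(k)λ(m) + O(log n · 1_{n = p^ν, p ∣ qP(z)})`", the `O`-term
vanishing here). [cite: MatomakiMerikoski2023, §2 (2.4)–(2.5)] -/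
theorem vonMangoldt_eq_charLog_sub_of_rough {z : ℝ} (hz : 1 < z) {n : ℕ} (hn : n ≠ 0)
    (hrough : ∀ p ∈ n.primeFactors, z ≤ (p : ℝ)) :
    Λ n = charLog χ n -
      ∑ m ∈ n.divisors.filter (fun m : ℕ => z ≤ (m : ℝ)), oneConvChi χ m * Λ (n / m) := by
  have h := charLog_sub_vonMangoldt χ hn
  have hset : n.divisors.filter (fun m : ℕ => z ≤ (m : ℝ)) = n.divisors.erase 1 := by
    ext m
    rw [Finset.mem_filter, Finset.mem_erase]
    constructor
    · rintro ⟨hm, hzm⟩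
      refine ⟨?_, hm⟩
      rintro rfl
      simp at hzm
      linarith
    · rintro ⟨hm1, hm⟩
      exact ⟨hm, le_of_dvd_of_rough hn hrough (Nat.dvd_of_mem_divisors hm) hm1⟩
  rw [hset, ← h]
  ring

/-- **The exceptional `n` of (2.4)**: if `Λ(n) ≠ 0` and `n` has a prime factor `p` with `p < z` or
`p ∣ q` (i.e. `(n, qP(z)) ≠ 1`), then `n = p^k`, `k ≥ 1`, for that prime ("`O(log n · 1_{n = p^ν,
p ∣ qP(z)})`"). [cite: MatomakiMerikoski2023, §2 (2.4)] -/
theorem eq_prime_pow_of_vonMangoldt_ne_zero {n : ℕ} (hΛ : Λ n ≠ 0) {p : ℕ} (hp : p ∈ n.primeFactors) :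
    ∃ k : ℕ, 0 < k ∧ n = p ^ k := by
  rw [ArithmeticFunction.vonMangoldt_ne_zero_iff] at hΛ
  have hmin := hΛ.minFac_pow_factorization_eq
  have hpmin : p = n.minFac := by
    obtain ⟨r, k, hr, hk, rfl⟩ := hΛ
    have hr' := Nat.prime_iff.mpr hr
    rw [Nat.mem_primeFactors] at hp
    have h1 : p = r := (Nat.prime_dvd_prime_iff_eq hp.1 hr').mp (hp.1.dvd_of_dvd_pow hp.2.1)
    rw [h1, hr'.pow_minFac hk.ne']
  refine ⟨n.factorization n.minFac, ?_, by rw [hpmin]; exact hmin.symm⟩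
  rw [← hpmin]
  exact Nat.Prime.factorization_pos_of_dvd (Nat.prime_of_mem_primeFactors hp)
    (Nat.pos_of_mem_primeFactors hp |>.ne' |> fun h => by
      exact (Nat.mem_primeFactors.mp hp).2.2) (Nat.dvd_of_mem_primeFactors hp)

/-! ### Prime powers in a dyadic window -/

open Classical in
/-- A dyadic window `[a, b]`, `b ≤ 2a`, `a ≥ 1`, contains at most two powers of a fixed `p ≥ 2`.
[folklore] -/
theorem card_filter_pow_le_two {p a b : ℕ} (hp : 2 ≤ p) (ha : 1 ≤ a) (hab : b ≤ 2 * a) :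
    ((Finset.Icc a b).filter (fun m => ∃ k : ℕ, m = p ^ k)).card ≤ 2 := by
  classical
  by_contra hlt
  rw [not_le, Finset.two_lt_card] at hlt
  obtain ⟨x, hx, y, hy, w, hw, hxy, hxw, hyw⟩ := hlt
  rw [Finset.mem_filter, Finset.mem_Icc] at hx hy hw
  obtain ⟨⟨hxa, hxb⟩, i, rfl⟩ := hx
  obtain ⟨⟨hya, hyb⟩, j, rfl⟩ := hy
  obtain ⟨⟨hwa, hwb⟩, l, rfl⟩ := hw
  have hij : i ≠ j := fun h => hxy (by rw [h])
  have hil : i ≠ l := fun h => hxw (by rw [h])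
  have hjl : j ≠ l := fun h => hyw (by rw [h])
  -- the largest and the smallest exponent differ by at least `2`
  have hp1 : 1 < p := by omega
  have key : ∀ i j : ℕ, i + 2 ≤ j → a ≤ p ^ i → p ^ j ≤ b → False := by
    intro i j hij hai hjb
    have h1 : p ^ i * p ^ 2 ≤ p ^ j := by
      rw [← pow_add]; exact Nat.pow_le_pow_right (by omega) hij
    have h2 : 4 ≤ p ^ 2 := by nlinarith
    nlinarith
  rcases lt_trichotomy i j with h1 | h1 | h1 <;> rcases lt_trichotomy i l with h2 | h2 | h2 <;>
    rcases lt_trichotomy j l with h3 | h3 | h3 <;> first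
    | omega
    | (exact key i l (by omega) hxa hwb)
    | (exact key i j (by omega) hxa hyb)
    | (exact key j l (by omega) hya hwb)
    | (exact key j i (by omega) hya hxb)
    | (exact key l i (by omega) hwa hxb)
    | (exact key l j (by omega) hwa hyb)

/-! ### (2.6): the expansion of `∑ g(n/X) Λ(n) Λ(n + h)` -/

/-- The algebra of (2.6) at one `n`: with `c = λ' − Λ`,
`λ'(n)λ'(n+h) − Λ(n)Λ(n+h) = λ'(n) c(n+h) + c(n) Λ(n+h)`. [cite: MatomakiMerikoski2023, §2 (2.6)] -/
theorem charLog_mul_sub_vonMangoldt_mul (n m : ℕ) :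
    charLog χ n * charLog χ m - Λ n * Λ m =
      charLog χ n * (charLog χ m - Λ m) + (charLog χ n - Λ n) * Λ m := by
  ring

open Classical in
/-- **Matomäki–Merikoski 2023, (2.6)** (the starting expansion of the proof of Theorems 1.3/1.4):
"When `g : ℝ → [0,1]` is a smooth function supported on `[1, 2]`, we obtain
`∑_n g(n/X) Λ(n)Λ(±n+h) = ∑_{n : (n(±n+h), qP(z)) = 1} g(n/X) λ'(n) λ'(±n+h)`
`+ O((z + ω(q)) log² X + log X ∑_{n ≤ 2X, (n(±n+h), qP(z)) = 1} (c_n τ(±n+h)² + τ(n) c_{±n+h}))`",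
for the sign `+` (the case of Theorem 1.3), with `λ' = χ ∗ log` (`TaoTeravainen.charLog`),
`c_n = λ'(n) − Λ(n) = ∑_{n = km, m ≥ z} Λ(k)λ(m)` on the admissible `n`
(`vonMangoldt_eq_charLog_sub_of_rough`), "`(m, qP(z)) = 1`" rendered as "every prime factor of
`m` is `≥ z` and does not divide `q`", and explicit constants: the difference is at most
`4 (π(z) + ω(q)) log²(2X + h) + log(2X + h) ∑_{adm} (τ(n) c_{n+h} + c_n)` (sharper than printed:
`π(z) ≤ z`, `c_n ≤ c_n τ(n+h)²`; smoothness of `g` is not used, only `0 ≤ g ≤ 1` and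
`supp g ⊆ [1, 2]`). Mechanism: on the admissible `n` the pointwise identity
`λ'λ'⁺ − ΛΛ⁺ = λ' c⁺ + c Λ⁺` with `0 ≤ λ' ≤ τ log`, `c ≥ 0`; elsewhere `Λ(n)Λ(n+h) ≠ 0` forces `n` or
`n + h` to be a power of a prime `p < z` or `p ∣ q`, and a dyadic window contains at most two
powers of each prime (`card_filter_pow_le_two`). [cite: MatomakiMerikoski2023, §2 (2.6)] -/
theorem MatomakiMerikoski2023_eq26 (hχ : χ.IsQuadratic) {X : ℝ} (hX : 1 ≤ X) (h : ℕ) (z : ℝ)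
    {q : ℕ} (hq : q ≠ 0) (g : ℝ → ℝ) (hg0 : ∀ x, 0 ≤ g x) (hg1 : ∀ x, g x ≤ 1)
    (hgs : ∀ x, g x ≠ 0 → 1 ≤ x ∧ x ≤ 2) :
    |∑ n ∈ Icc 1 ⌊2 * X⌋₊, g (n / X) * Λ n * Λ (n + h) -
        ∑ n ∈ (Icc 1 ⌊2 * X⌋₊).filter (fun n : ℕ =>
          (∀ p ∈ n.primeFactors, z ≤ (p : ℝ) ∧ ¬ p ∣ q) ∧
            (∀ p ∈ (n + h).primeFactors, z ≤ (p : ℝ) ∧ ¬ p ∣ q)),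
          g (n / X) * charLog χ n * charLog χ (n + h)| ≤
      4 * ((Nat.primesBelow ⌈z⌉₊).card + q.primeFactors.card) * Real.log (2 * X + h) ^ 2 +
        Real.log (2 * X + h) *
          ∑ n ∈ (Icc 1 ⌊2 * X⌋₊).filter (fun n : ℕ =>
            (∀ p ∈ n.primeFactors, z ≤ (p : ℝ) ∧ ¬ p ∣ q) ∧
              (∀ p ∈ (n + h).primeFactors, z ≤ (p : ℝ) ∧ ¬ p ∣ q)),
            ((n.divisors.card : ℝ) * (charLog χ (n + h) - Λ (n + h)) + (charLog χ n - Λ n)) := by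
  have hX0 : 0 < X := by linarith
  set S := Icc 1 ⌊2 * X⌋₊ with hS
  set Adm : ℕ → Prop := fun n => (∀ p ∈ n.primeFactors, z ≤ (p : ℝ) ∧ ¬ p ∣ q) ∧
    (∀ p ∈ (n + h).primeFactors, z ≤ (p : ℝ) ∧ ¬ p ∣ q) with hAdm
  set L : ℝ := Real.log (2 * X + h) with hL
  have hL0 : 0 ≤ L := Real.log_nonneg (by have := (Nat.cast_nonneg h : (0:ℝ) ≤ h); linarith)
  -- sizes of the factors on `S`
  have hnS : ∀ n ∈ S, 1 ≤ n ∧ (n : ℝ) ≤ 2 * X := by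
    intro n hn
    rw [hS, Finset.mem_Icc] at hn
    exact ⟨hn.1, (Nat.le_floor_iff (by linarith)).mp hn.2⟩
  have hlogn : ∀ n ∈ S, Real.log n ≤ L := by
    intro n hn
    obtain ⟨h1, h2⟩ := hnS n hn
    have : (1 : ℝ) ≤ n := by exact_mod_cast h1
    exact Real.log_le_log (by linarith) (by have := (Nat.cast_nonneg h : (0:ℝ) ≤ h); linarith)
  have hlognh : ∀ n ∈ S, Real.log ((n + h : ℕ) : ℝ) ≤ L := by
    intro n hn
    obtain ⟨h1, h2⟩ := hnS n hn
    have : (1 : ℝ) ≤ n := by exact_mod_cast h1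
    push_cast
    exact Real.log_le_log (by positivity) (by linarith)
  have hΛn : ∀ n ∈ S, Λ n ≤ L := fun n hn =>
    ArithmeticFunction.vonMangoldt_le_log.trans (hlogn n hn)
  have hΛnh : ∀ n ∈ S, Λ (n + h) ≤ L := fun n hn =>
    ArithmeticFunction.vonMangoldt_le_log.trans (by exact_mod_cast hlognh n hn)
  -- Part 1: the admissible `n`
  have hadm : ∀ n ∈ S, |g (n / X) * Λ n * Λ (n + h) - g (n / X) * charLog χ n * charLog χ (n + h)| ≤
      L * ((n.divisors.card : ℝ) * (charLog χ (n + h) - Λ (n + h)) + (charLog χ n - Λ n)) := by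
    intro n hn
    obtain ⟨hn1, -⟩ := hnS n hn
    have hn0 : n ≠ 0 := by omega
    have hnh0 : n + h ≠ 0 := by omega
    obtain ⟨hc0, hc1⟩ := charLog_sub_vonMangoldt_bounds χ hχ hn0
    obtain ⟨hc0', -⟩ := charLog_sub_vonMangoldt_bounds χ hχ hnh0
    have hl0 : 0 ≤ charLog χ n := charLog_nonneg χ hχ n
    have hl1 : charLog χ n ≤ (n.divisors.card : ℝ) * L :=
      (charLog_le χ n).trans (mul_le_mul_of_nonneg_left (hlogn n hn) (Nat.cast_nonneg _))
    have hΛ0 : 0 ≤ Λ (n + h) := ArithmeticFunction.vonMangoldt_nonneg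
    have hid : g (n / X) * Λ n * Λ (n + h) - g (n / X) * charLog χ n * charLog χ (n + h) =
        -(g (n / X) * (charLog χ n * (charLog χ (n + h) - Λ (n + h)) + (charLog χ n - Λ n) * Λ (n + h))) := by
      ring
    rw [hid, abs_neg]
    have hin : 0 ≤ charLog χ n * (charLog χ (n + h) - Λ (n + h)) + (charLog χ n - Λ n) * Λ (n + h) := by
      positivity
    rw [abs_of_nonneg (mul_nonneg (hg0 _) hin)]
    calc g (n / X) * (charLog χ n * (charLog χ (n + h) - Λ (n + h)) + (charLog χ n - Λ n) * Λ (n + h))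
        ≤ 1 * (charLog χ n * (charLog χ (n + h) - Λ (n + h)) + (charLog χ n - Λ n) * Λ (n + h)) :=
          mul_le_mul_of_nonneg_right (hg1 _) hin
      _ ≤ (n.divisors.card : ℝ) * L * (charLog χ (n + h) - Λ (n + h)) + (charLog χ n - Λ n) * L := by
          rw [one_mul]
          gcongr
          exact hΛnh n hn
      _ = L * ((n.divisors.card : ℝ) * (charLog χ (n + h) - Λ (n + h)) + (charLog χ n - Λ n)) := by
          ring
  -- Part 2: the exceptional `n`
  set Pbad : Finset ℕ := Nat.primesBelow ⌈z⌉₊ ∪ q.primeFactors with hPbad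
  have hPbad_mem : ∀ {m p : ℕ}, p ∈ m.primeFactors → (z ≤ (p : ℝ) → p ∣ q) → p ∈ Pbad := by
    intro m p hp hneg
    have hp' := Nat.prime_of_mem_primeFactors hp
    rw [hPbad, Finset.mem_union, Nat.mem_primesBelow, Nat.mem_primeFactors]
    by_cases hpq : p ∣ q
    · exact Or.inr ⟨hp', hpq, hq⟩
    · left
      refine ⟨Nat.lt_ceil.mpr ?_, hp'⟩
      by_contra hge
      exact hpq (hneg (not_lt.mp hge))
  set a : ℕ := ⌈X⌉₊ with ha
  set b : ℕ := ⌊2 * X⌋₊ with hb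
  have ha1 : 1 ≤ a := Nat.one_le_iff_ne_zero.mpr (by rw [ha, Ne, Nat.ceil_eq_zero]; linarith)
  have hab : b ≤ 2 * a := by
    have h1 : (b : ℝ) ≤ 2 * X := Nat.floor_le (by linarith)
    have h2 : X ≤ a := Nat.le_ceil X
    exact_mod_cast (show (b : ℝ) ≤ 2 * a by linarith)
  have habh : b + h ≤ 2 * (a + h) := by omega
  set T₁ : Finset ℕ := Pbad.biUnion (fun p => (Icc a b).filter (fun m => ∃ k : ℕ, m = p ^ k)) with hT₁
  set T₂ : Finset ℕ := Pbad.biUnion (fun p => (Icc a b).filter (fun m => ∃ k : ℕ, m + h = p ^ k))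
    with hT₂
  have hT₁card : T₁.card ≤ 2 * Pbad.card := by
    refine Finset.card_biUnion_le.trans ?_
    rw [mul_comm, ← smul_eq_mul, ← Finset.sum_const]
    refine Finset.sum_le_sum fun p hp => ?_
    have hp2 : 2 ≤ p := by
      rw [hPbad, Finset.mem_union, Nat.mem_primesBelow] at hp
      rcases hp with hp | hp
      · exact hp.2.two_le
      · exact (Nat.prime_of_mem_primeFactors hp).two_le
    exact card_filter_pow_le_two hp2 ha1 hab
  have hT₂card : T₂.card ≤ 2 * Pbad.card := by
    refine Finset.card_biUnion_le.trans ?_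
    rw [mul_comm, ← smul_eq_mul, ← Finset.sum_const]
    refine Finset.sum_le_sum fun p hp => ?_
    have hp2 : 2 ≤ p := by
      rw [hPbad, Finset.mem_union, Nat.mem_primesBelow] at hp
      rcases hp with hp | hp
      · exact hp.2.two_le
      · exact (Nat.prime_of_mem_primeFactors hp).two_le
    have hinj : ((Icc a b).filter (fun m => ∃ k : ℕ, m + h = p ^ k)).card ≤
        ((Icc (a + h) (b + h)).filter (fun m => ∃ k : ℕ, m = p ^ k)).card := by
      refine Finset.card_le_card_of_injOn (fun m => m + h) (fun m hm => ?_) (fun m _ m' _ hmm' => by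
        simpa using hmm')
      simp only [Finset.coe_filter, Set.mem_setOf_eq, Finset.mem_Icc] at hm ⊢
      exact ⟨⟨by omega, by omega⟩, hm.2⟩
    exact hinj.trans (card_filter_pow_le_two hp2 (by omega) habh)
  have hexc : ∀ n ∈ S.filter (fun n => ¬ Adm n), g (n / X) * Λ n * Λ (n + h) ≤
      if n ∈ T₁ ∪ T₂ then L ^ 2 else 0 := by
    intro n hn
    rw [Finset.mem_filter] at hn
    obtain ⟨hnS', hnA⟩ := hn
    obtain ⟨hn1, hn2X⟩ := hnS n hnS'
    have hterm0 : 0 ≤ g (n / X) * Λ n * Λ (n + h) :=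
      mul_nonneg (mul_nonneg (hg0 _) ArithmeticFunction.vonMangoldt_nonneg)
        ArithmeticFunction.vonMangoldt_nonneg
    have htermL : g (n / X) * Λ n * Λ (n + h) ≤ L ^ 2 := by
      calc g (n / X) * Λ n * Λ (n + h) ≤ 1 * L * L := by
            refine mul_le_mul (mul_le_mul (hg1 _) (hΛn n hnS') ArithmeticFunction.vonMangoldt_nonneg
              zero_le_one) (hΛnh n hnS') ArithmeticFunction.vonMangoldt_nonneg (by positivity)
        _ = L ^ 2 := by ring
    by_cases hzero : g (n / X) * Λ n * Λ (n + h) = 0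
    · rw [hzero]; split_ifs <;> positivity
    · have hg' : g (n / X) ≠ 0 := fun h0 => hzero (by rw [h0]; ring)
      have hΛ1 : Λ n ≠ 0 := fun h0 => hzero (by rw [h0]; ring)
      have hΛ2 : Λ (n + h) ≠ 0 := fun h0 => hzero (by rw [h0]; ring)
      obtain ⟨hx1, hx2⟩ := hgs _ hg'
      have hna : a ≤ n := by
        rw [ha]; refine Nat.ceil_le.mpr ?_
        rwa [le_div_iff₀ hX0, one_mul] at hx1
      have hnb : n ≤ b := by
        rw [hb]; refine Nat.le_floor ?_
        rwa [div_le_iff₀ hX0] at hx2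
      have hmem : n ∈ T₁ ∪ T₂ := by
        rw [Finset.mem_union]
        rw [hAdm] at hnA
        simp only [not_and_or, not_forall, not_not, exists_prop] at hnA
        rcases hnA with ⟨p, hp, hpbad⟩ | ⟨p, hp, hpbad⟩
        · left
          rw [hT₁, Finset.mem_biUnion]
          refine ⟨p, hPbad_mem hp (fun hz => hpbad.resolve_left (not_not.mpr hz)), ?_⟩
          rw [Finset.mem_filter, Finset.mem_Icc]
          obtain ⟨k, -, hk⟩ := eq_prime_pow_of_vonMangoldt_ne_zero hΛ1 hp
          exact ⟨⟨hna, hnb⟩, k, hk⟩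
        · right
          rw [hT₂, Finset.mem_biUnion]
          refine ⟨p, hPbad_mem hp (fun hz => hpbad.resolve_left (not_not.mpr hz)), ?_⟩
          rw [Finset.mem_filter, Finset.mem_Icc]
          obtain ⟨k, -, hk⟩ := eq_prime_pow_of_vonMangoldt_ne_zero hΛ2 hp
          exact ⟨⟨hna, hnb⟩, k, hk⟩
      rw [if_pos hmem]
      exact htermL
  -- assemble
  have hsplit : ∑ n ∈ S, g (n / X) * Λ n * Λ (n + h) =
      ∑ n ∈ S.filter (fun n => Adm n), g (n / X) * Λ n * Λ (n + h) +
        ∑ n ∈ S.filter (fun n => ¬ Adm n), g (n / X) * Λ n * Λ (n + h) :=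
    (Finset.sum_filter_add_sum_filter_not S Adm _).symm
  have hpart1 : |∑ n ∈ S.filter (fun n => Adm n), g (n / X) * Λ n * Λ (n + h) -
      ∑ n ∈ S.filter (fun n => Adm n), g (n / X) * charLog χ n * charLog χ (n + h)| ≤
      L * ∑ n ∈ S.filter (fun n => Adm n),
        ((n.divisors.card : ℝ) * (charLog χ (n + h) - Λ (n + h)) + (charLog χ n - Λ n)) := by
    rw [← Finset.sum_sub_distrib, Finset.mul_sum]
    refine (Finset.abs_sum_le_sum_abs _ _).trans (Finset.sum_le_sum fun n hn => ?_)
    exact hadm n (Finset.mem_filter.mp hn).1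
  have hpart2 : |∑ n ∈ S.filter (fun n => ¬ Adm n), g (n / X) * Λ n * Λ (n + h)| ≤
      4 * ((Nat.primesBelow ⌈z⌉₊).card + q.primeFactors.card) * L ^ 2 := by
    have h0 : 0 ≤ ∑ n ∈ S.filter (fun n => ¬ Adm n), g (n / X) * Λ n * Λ (n + h) :=
      Finset.sum_nonneg fun n _ => mul_nonneg (mul_nonneg (hg0 _) ArithmeticFunction.vonMangoldt_nonneg)
        ArithmeticFunction.vonMangoldt_nonneg
    rw [abs_of_nonneg h0]
    calc ∑ n ∈ S.filter (fun n => ¬ Adm n), g (n / X) * Λ n * Λ (n + h)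
        ≤ ∑ n ∈ S.filter (fun n => ¬ Adm n), (if n ∈ T₁ ∪ T₂ then L ^ 2 else 0) :=
          Finset.sum_le_sum hexc
      _ = ∑ n ∈ (S.filter (fun n => ¬ Adm n)).filter (fun n => n ∈ T₁ ∪ T₂), L ^ 2 :=
          (Finset.sum_filter (fun n => n ∈ T₁ ∪ T₂) (fun _ => L ^ 2)).symm
      _ ≤ ∑ n ∈ T₁ ∪ T₂, L ^ 2 := by
          refine Finset.sum_le_sum_of_subset_of_nonneg (fun n hn => (Finset.mem_filter.mp hn).2)
            fun _ _ _ => by positivity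
      _ = ((T₁ ∪ T₂).card : ℝ) * L ^ 2 := by rw [Finset.sum_const, nsmul_eq_mul]
      _ ≤ (4 * Pbad.card : ℝ) * L ^ 2 := by
          refine mul_le_mul_of_nonneg_right ?_ (by positivity)
          have := Finset.card_union_le T₁ T₂
          exact_mod_cast (show ((T₁ ∪ T₂).card : ℝ) ≤ 4 * Pbad.card by
            exact_mod_cast (by omega : (T₁ ∪ T₂).card ≤ 4 * Pbad.card))
      _ ≤ 4 * ((Nat.primesBelow ⌈z⌉₊).card + q.primeFactors.card) * L ^ 2 := by
          refine mul_le_mul_of_nonneg_right ?_ (by positivity)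
          have := Finset.card_union_le (Nat.primesBelow ⌈z⌉₊) q.primeFactors
          rw [hPbad]
          exact_mod_cast (show (4 : ℝ) * ((Nat.primesBelow ⌈z⌉₊ ∪ q.primeFactors).card : ℝ) ≤
            4 * ((Nat.primesBelow ⌈z⌉₊).card + q.primeFactors.card : ℕ) by
              exact_mod_cast (by omega :
                4 * (Nat.primesBelow ⌈z⌉₊ ∪ q.primeFactors).card ≤
                  4 * ((Nat.primesBelow ⌈z⌉₊).card + q.primeFactors.card)))
  rw [hsplit]
  have htri : ∀ A B M : ℝ, |A + B - M| ≤ |A - M| + |B| := fun A B M => by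
    calc |A + B - M| = |(A - M) + B| := by ring_nf
      _ ≤ |A - M| + |B| := abs_add_le _ _
  refine (htri _ _ _).trans ?_
  linarith [hpart1, hpart2]

end Literature.Barriers.Parity.MatomakiMerikoski
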